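import Literature.Algebra.Lie.LefschetzAlgebra
import Literature.Algebra.Lie.FrobeniusLefschetzModule
import HarnessLib

/-!
# A Lefschetz algebra `A` is generated by `A_2` iff `A[n]` is a Frobenius–Lefschetz module (Looijenga–Lunts 1997, §6 (6.1)); derivations of such `A` ((2.11))

Topic `Literature/Algebra/Lie` (namespace `Literature.Algebra.Lie`).  Lane `lit-hodgefound` (Track 2 foundations
library), skeleton seat `lit-hodgefound-skel-1` (generation 48), row **A1-159** of
`run/shared/lean/pub/lit-hodgefound/SKELETON.md`: the remark following Looijenga–Lunts' definition (6.1) — for a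
LEFSCHETZ ALGEBRA `A` of depth `n` (A1-119 `IsLefschetzAlgebra`: graded-commutative `A = ⊕_{i ≤ 2n} A_i`, `A_0 = K`,
`A[n]` a Lefschetz module of depth `n` over `A_2`), the Lefschetz module `A[n]` of `𝔞 = {L_a | a ∈ A_2}` is
FROBENIUS (A1-156 `IsFrobeniusLefschetz`) if and only if `A` is generated by `A_2` as a `K`-algebra.  THEOREMS ONLY
(no definition, no named fact, no `sorry`; D-0026 net debt `0`; no local instances), on top of A1-119
`LefschetzAlgebra` (`shiftedDegree`, `mulLeftDegTwo`, `degreeSpace_shiftedDegree_eq`) and A1-156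
`FrobeniusLefschetzModule` (`envelopingSpan`, `actionMap`, `IsFrobeniusLefschetz.mk'`).

Rider **A1-160** (§5–§6, same seat and generation) adds Looijenga–Lunts' (2.11), first assertion, in the same setting:
an operator of `𝔤𝔩(A)` normalising the left multiplications by the generators `A_2` (as the degree-`0` part `𝔤_0` of
a Jordan–Lefschetz pair does on the algebra `A = U𝔤_2/I` of (2.10), which is generated by `A_2 = 𝔤_2`) acts as a
DERIVATION of `A` if and only if it kills `1` — by the printed induction over the generated algebra.

## Source, VERBATIM

E. Looijenga, V. A. Lunts, *A Lie algebra attached to a projective variety*, Invent. Math. **129** (1997) 361–412,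
§6 (6.1) (held TeX text `paper:arxiv-alg-geom_9604014`, p0023 L11–L30; held PDF text `paper:arxiv-alg-geom-9604014`
p0052 L1–L11) and §2 (2.10)–(2.11) (TeX p0011 L19–L44; PDF p0022 L3–L7):

> "(6.1) We say that a Lefschetz module `(M, 𝔞)` of depth `n` is Frobenius if it satisfies the following three
> properties: (1) `Prim M_{-n} = 1` is of dimension one (and so `M` is irreducible), (2) the map
> `𝔞 ⊗ M_{-n} → M_{-n+2}` is an isomorphism, (3) `M` is generated as a `U𝔞`-module by `M_{-n}`. […]
> Observe that if `A` is Lefschetz algebra of depth `n`, then `A[n]` is a Frobenius–Lefschetz module of `A_2` if and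
> only if `A` is generated by `A_2`. Moreover, any Frobenius–Lefschetz module is of this form."

> "(2.10) The Jordan–Lefschetz modules give rise to Frobenius algebra's with remarkable properties. Let `(𝔤, h)` be a
> Jordan pair and let `M` be a Jordan–Lefschetz module of `(𝔤, h)` of depth `n`. Then `M` is a monic module over the
> commutative algebra `U𝔤_2`. So if `I ⊂ U𝔤_2` denote the annihilator of `M`, then `I` defines the origin in
> `Spec(U𝔤_2) = 𝔤_2^*` with local algebra `A := U𝔤_2/I`. The latter is an evenly graded Lefschetz algebra that has `M`
> as a free graded module of rank one. The next proposition shows that it has a lot of automorphisms. Let `𝔤'_0` be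
> the Lie subalgebra of `𝔤_0` that kills `1 ∈ A_0` (or equivalently, kills `M_{-n}`); this Lie algebra is
> complementary to the span of `h` in `𝔤_0`.
> (2.11) Proposition. The Lie algebra `𝔤'_0` acts on `A` as derivations and so the associated Lie subgroup of
> `GL(A)` is a group of algebra automorphisms of `A`. Moreover, the Lie subgroup `G_0 ⊂ GL(A)` associated to `𝔤_0`
> has a dense orbit in `A_2` consisting of Lefschetz elements.
> Proof. If `u ∈ 𝔤_0` and `e ∈ 𝔤_2`, then for all `x ∈ A`, `u(ex) = [u, e]x + e(ux)`. Since `A` is generated by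
> `𝔤_2`, it follows with induction that `u` acts as a derivation if (and only if) `u` kills `1`. The last assertion
> follows from a well-known result [Bourbaki], Ch. VIII, 11, Prop. 6."

## Rendering (dictionary)

* "`A` is Lefschetz algebra of depth `n`": `IsLefschetzAlgebra K 𝒜 n` for a Mathlib grading `𝒜 : ℕ → Submodule K A`,
  `[GradedAlgebra 𝒜]` (A1-119); "`A[n]` … of `A_2`": the pair `(h, 𝔞) = (shiftedDegree K 𝒜 n, mulLeftDegTwo K 𝒜)`
  of A1-119 (`h = i - n` on `A_i`; `𝔞 = {L_a | a ∈ A_2} ⊆ 𝔤𝔩(A)`).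
* "Frobenius–Lefschetz module": `IsFrobeniusLefschetz K (shiftedDegree K 𝒜 n) (mulLeftDegTwo K 𝒜)` (A1-156).
* "`A` is generated by `A_2`": `Algebra.adjoin K (𝒜 2 : Set A) = ⊤`.
* "`U𝔞`" `= Algebra.adjoin K 𝔞 ⊆ 𝔤𝔩(A)` is the image of `K⟨A_2⟩ = Algebra.adjoin K A_2 ⊆ A` under the algebra map
  `L : A → 𝔤𝔩(A)` (Mathlib `Algebra.lmul`): `adjoin_mulLeftDegTwo_eq`.

## Contents (all proved)

* §1 `adjoin_mulLeftDegTwo_eq` (`U𝔞 = L(K⟨A_2⟩)`), `mul_mem_adjoin_mulLeftDegTwo`, `exists_eq_mul_of_mem_adjoin_mulLeftDegTwo`;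
  `IsLefschetzAlgebra.degreeZero_eq_span_one` (`A_0 = K · 1`), `IsLefschetzAlgebra.nontrivial`,
  **`IsLefschetzAlgebra.finrank_degreeZero`** (`dim A_0 = 1` — (1) for `A[n]_{-n} = A_0`).
* §2 (3) ⟺ generation: **`envelopingSpan_mulLeftDegTwo_eq_top`** (generated by `A_2` ⟹ `U𝔞 · A_0 = A`) and
  **`adjoin_degreeTwo_eq_top_of_envelopingSpan_eq_top`** (conversely).
* §3 (2): `IsLefschetzAlgebra.exists_eq_tmul_one` (`𝔞 ⊗ A_0 = {u ⊗ 1}`), **`IsLefschetzAlgebra.injective_actionMap`**,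
  **`IsLefschetzAlgebra.range_actionMap`** (`= A_2`).
* §4 `degreeSpace_shiftedDegree_neg` (`A[n]_{-n} = A_0`), `degreeSpace_shiftedDegree_neg_add_two` (`A[n]_{-n+2} = A_2`),
  and the remark **`IsLefschetzAlgebra.isFrobeniusLefschetz_iff`**:
  `IsFrobeniusLefschetz K (shiftedDegree K 𝒜 n) (mulLeftDegTwo K 𝒜) ↔ Algebra.adjoin K (𝒜 2) = ⊤` — (⇒) by (3)
  alone; (⇐) by `dim A_0 = 1`, (2), (3) and A1-156 `IsFrobeniusLefschetz.mk'` (the clause `Prim = A_0` is automatic).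
* §5 (rider A1-160) (2.11)'s induction in general: `map_one_eq_zero_of_leibniz`, `apply_mul_eq_lie_apply_add`
  ("`u(ex) = [u, e]x + e(ux)`"), `leibniz_left_of_lie_mul_mem_range`, and
  **`leibniz_iff_map_one_eq_zero_of_adjoin_eq_top`**: for `A` generated by `S` and `u ∈ 𝔤𝔩(A)` with
  `[u, L_s] ∈ L(A)` (`s ∈ S`), `u` is a derivation iff `u(1) = 0`.
* §6 (rider A1-160) **`leibniz_iff_map_one_eq_zero_of_adjoin_degTwo_eq_top`** (the case `S = A_2`, `[u, L_{A_2}] ⊆ L_{A_2}`)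
  and `IsLefschetzAlgebra.existsUnique_add_smul_shiftedDegree_map_one` ("`𝔤'_0` … kills `1` … is complementary to
  the span of `h` in `𝔤_0`": an operator with `u(1) ∈ A_0` is corrected to one killing `1` by a unique multiple of `h`).

## SCOPE (not formalised here)

(a) "Moreover, any Frobenius–Lefschetz module is of this form" — the converse construction (the graded algebra
`R = U𝔞 ≅ M` of (6.3), A1-156 `evalGenEquiv`, as a Lefschetz algebra with `R[n] ≅ M`) is not packaged as a
`GradedAlgebra` here.  (b) "We also note that a Jordan–Lefschetz module is Frobenius" — not formalised.  (c) By
(6.3) (A1-156 `IsFrobeniusLefschetz.exists_bilinForm`) a Lefschetz algebra generated by `A_2` carries a non-degenerate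
`𝔤(A_2, A[n])`-invariant `(-)^n`-symmetric form; this corollary is left to files enabling the Lie structure of
`𝔤𝔩(A)` (compare (1.4)'s `lefschetzForm`, A1-119/A1-122).  (d) Of (2.10)–(2.11) only the first assertion of the
Proposition (derivations ⟺ killing `1`, for operators normalising `L_{A_2}`) and the complement remark are
formalised: the construction `A = U𝔤_2/I` for a Jordan–Lefschetz module, "`𝔤'_0` acts on `A`" as a statement about
the Lie algebra `𝔤_0` of a Jordan pair, the Lie subgroups of `GL(A)` and the dense orbit of Lefschetz elements
([Bourbaki] VIII §11 Prop. 6) are NOT.  (e) Nothing here concerns complex tori or the Hodge conjecture.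

## References

* [LooijengaLunts1997] E. Looijenga, V. A. Lunts, *A Lie algebra attached to a projective variety*, Invent. Math. 129
  (1997) 361–412; arXiv:alg-geom/9604014. §6 (6.1), p. 23 L11–L30 of the held TeX text (`paper:arxiv-alg-geom_9604014`);
  §1 (1.4) p. 5 L17–L27; §2 (2.10)–(2.11) p. 11 L19–L44.
-/

namespace Literature.Algebra.Lie

open Module Function Set
open scoped TensorProduct

section LefschetzAlgebra

variable (K : Type*) [Field K] {A : Type*} [Ring A] [Algebra K A] (𝒜 : ℕ → Submodule K A) [GradedAlgebra 𝒜]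

/-! ### §1 `A[n]_{-n} = A_0 = K · 1` and `U𝔞 = L(K⟨A_2⟩)` -/

omit [GradedAlgebra 𝒜] in
/-- `U𝔞` for `𝔞 = {L_a | a ∈ A_2}` is the image under `L : A → 𝔤𝔩(A)` (`a ↦ L_a`, an algebra homomorphism, Mathlib
`Algebra.lmul`) of the subalgebra `K⟨A_2⟩` of `A` generated by `A_2`. [cite: LooijengaLunts1997, §6 (6.1) p. 23 L20, L28–L29 ("M is generated as a U𝔞-module by M_{-n}", "A is generated by A_2")] -/
theorem adjoin_mulLeftDegTwo_eq :
    Algebra.adjoin K (mulLeftDegTwo K 𝒜 : Set (Module.End K A)) =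
      (Algebra.adjoin K (𝒜 2 : Set A)).map (Algebra.lmul K A) := by
  rw [AlgHom.map_adjoin, Algebra.coe_lmul_eq_mul]
  rfl

omit [GradedAlgebra 𝒜] in
/-- `L_x ∈ U𝔞` for `x ∈ K⟨A_2⟩`. [cite: LooijengaLunts1997, §6 (6.1) p. 23 L20, L28–L29] -/
theorem mul_mem_adjoin_mulLeftDegTwo {x : A} (hx : x ∈ Algebra.adjoin K (𝒜 2 : Set A)) :
    LinearMap.mul K A x ∈ Algebra.adjoin K (mulLeftDegTwo K 𝒜 : Set (Module.End K A)) := by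
  rw [adjoin_mulLeftDegTwo_eq]
  exact ⟨x, hx, rfl⟩

omit [GradedAlgebra 𝒜] in
/-- Conversely every element of `U𝔞` is `L_x` for some `x ∈ K⟨A_2⟩`. [cite: LooijengaLunts1997, §6 (6.1) p. 23 L20, L28–L29] -/
theorem exists_eq_mul_of_mem_adjoin_mulLeftDegTwo {P : Module.End K A}
    (hP : P ∈ Algebra.adjoin K (mulLeftDegTwo K 𝒜 : Set (Module.End K A))) :
    ∃ x ∈ Algebra.adjoin K (𝒜 2 : Set A), LinearMap.mul K A x = P := by
  rw [adjoin_mulLeftDegTwo_eq] at hP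
  obtain ⟨x, hx, rfl⟩ := hP
  exact ⟨x, hx, rfl⟩

variable {K 𝒜} {n : ℕ}

/-- **`A_0 = K · 1` in a Lefschetz algebra** ("with `A_0 = K`"). [cite: LooijengaLunts1997, §1 (1.4) p. 5 L17–L18] -/
theorem IsLefschetzAlgebra.degreeZero_eq_span_one (L : IsLefschetzAlgebra K 𝒜 n) : 𝒜 0 = K ∙ (1 : A) := by
  refine le_antisymm (fun x hx ↦ ?_) ((Submodule.span_singleton_le_iff_mem _ _).2 (SetLike.GradedOne.one_mem))
  obtain ⟨c, rfl⟩ := L.exists_algebraMap_eq x hx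
  rw [Algebra.algebraMap_eq_smul_one]
  exact Submodule.smul_mem _ c (Submodule.mem_span_singleton_self _)

/-- A Lefschetz algebra is non-zero (`h ≠ 0`). [cite: LooijengaLunts1997, §1 (1.4) p. 5 L17–L20] -/
theorem IsLefschetzAlgebra.nontrivial (L : IsLefschetzAlgebra K 𝒜 n) : Nontrivial A := by
  by_contra hA
  rw [not_nontrivial_iff_subsingleton] at hA
  exact L.shiftedDegree_ne_zero (Subsingleton.elim _ _)

/-- **`dim A_0 = 1`** ("(1) … is of dimension one" for `A[n]_{-n} = A_0`). [cite: LooijengaLunts1997, §6 (6.1) (1) p. 23 L14, L28–L29] -/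
theorem IsLefschetzAlgebra.finrank_degreeZero (L : IsLefschetzAlgebra K 𝒜 n) : Module.finrank K (𝒜 0) = 1 := by
  haveI := L.nontrivial
  rw [L.degreeZero_eq_span_one, finrank_span_singleton one_ne_zero]

/-! ### §2 "(3) `A[n]` is generated as a `U𝔞`-module by `A[n]_{-n} = A_0`" iff "`A` is generated by `A_2`" -/

/-- **(⇐) If `A` is generated by `A_2` then `U𝔞 · A_0 = A`**: `x = L_x 1` with `L_x ∈ U𝔞` for `x ∈ K⟨A_2⟩ = A`.
[cite: LooijengaLunts1997, §6 (6.1) p. 23 L20, L28–L29] -/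
theorem envelopingSpan_mulLeftDegTwo_eq_top (htop : Algebra.adjoin K (𝒜 2 : Set A) = ⊤) :
    envelopingSpan (mulLeftDegTwo K 𝒜) (𝒜 0) = ⊤ := by
  rw [eq_top_iff]
  intro x _
  have hx : x ∈ Algebra.adjoin K (𝒜 2 : Set A) := by rw [htop]; exact Algebra.mem_top
  have h1 := apply_mem_envelopingSpan_of_mem (S := 𝒜 0) (mul_mem_adjoin_mulLeftDegTwo K 𝒜 hx)
    (SetLike.GradedOne.one_mem (A := 𝒜))
  rwa [LinearMap.mul_apply', mul_one] at h1

/-- **(⇒) If `U𝔞 · A_0 = A` then `A` is generated by `A_2`**: every `x ∈ A` is `P · 1` with `P = L_y ∈ U𝔞`,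
`y ∈ K⟨A_2⟩`, i.e. `x = y`. [cite: LooijengaLunts1997, §6 (6.1) p. 23 L20, L28–L29] -/
theorem adjoin_degreeTwo_eq_top_of_envelopingSpan_eq_top (L : IsLefschetzAlgebra K 𝒜 n)
    (htop : envelopingSpan (mulLeftDegTwo K 𝒜) (𝒜 0) = ⊤) : Algebra.adjoin K (𝒜 2 : Set A) = ⊤ := by
  rw [eq_top_iff]
  intro x _
  have hx : x ∈ envelopingSpan (mulLeftDegTwo K 𝒜) (K ∙ (1 : A)) := by
    rw [← L.degreeZero_eq_span_one, htop]; exact Submodule.mem_top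
  obtain ⟨P, hP, rfl⟩ := mem_envelopingSpan_span_singleton_iff.1 hx
  obtain ⟨y, hy, rfl⟩ := exists_eq_mul_of_mem_adjoin_mulLeftDegTwo K 𝒜 hP
  rwa [LinearMap.mul_apply', mul_one]

/-! ### §3 "(2) the map `𝔞 ⊗ A[n]_{-n} → A[n]_{-n+2}` is an isomorphism": `K L_a ⊗ K 1 → A_2`, `L_a ⊗ 1 ↦ a` -/

/-- Every element of `𝔞 ⊗ A_0` is an elementary tensor `u ⊗ 1`, `u ∈ 𝔞` (`A_0 = K · 1`).
[cite: LooijengaLunts1997, §6 (6.1) (2) p. 23 L17–L18, L28–L29] -/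
theorem IsLefschetzAlgebra.exists_eq_tmul_one (L : IsLefschetzAlgebra K 𝒜 n) (t : ↥(mulLeftDegTwo K 𝒜) ⊗[K] ↥(𝒜 0)) :
    ∃ u : ↥(mulLeftDegTwo K 𝒜), t = u ⊗ₜ ⟨1, SetLike.GradedOne.one_mem⟩ := by
  induction t using TensorProduct.induction_on with
  | zero => exact ⟨0, by rw [TensorProduct.zero_tmul]⟩
  | tmul u v =>
    have hv : (v : A) ∈ K ∙ (1 : A) := by rw [← L.degreeZero_eq_span_one]; exact v.2
    obtain ⟨c, hc⟩ := Submodule.mem_span_singleton.1 hv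
    refine ⟨c • u, ?_⟩
    have hv' : v = c • ⟨1, SetLike.GradedOne.one_mem⟩ := Subtype.ext hc.symm
    rw [hv', TensorProduct.tmul_smul, TensorProduct.smul_tmul']
  | add x y hx hy =>
    obtain ⟨u, rfl⟩ := hx
    obtain ⟨u', rfl⟩ := hy
    exact ⟨u + u', by rw [TensorProduct.add_tmul]⟩

/-- **(2), injectivity**: `𝔞 ⊗ A_0 → A`, `L_a ⊗ c ↦ c a`, is injective. [cite: LooijengaLunts1997, §6 (6.1) (2) p. 23 L17–L18, L28–L29] -/
theorem IsLefschetzAlgebra.injective_actionMap (L : IsLefschetzAlgebra K 𝒜 n) :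
    Function.Injective (actionMap K (mulLeftDegTwo K 𝒜) (𝒜 0)) := by
  refine (injective_iff_map_eq_zero _).2 fun t ht ↦ ?_
  obtain ⟨u, rfl⟩ := L.exists_eq_tmul_one t
  rw [actionMap_tmul] at ht
  obtain ⟨a, ha, hau⟩ := (mem_mulLeftDegTwo_iff K 𝒜).1 u.2
  have ha0 : a = 0 := by
    have h1 : (u : Module.End K A) 1 = a := by rw [← hau, LinearMap.mul_apply', mul_one]
    rw [← h1]
    exact ht
  have hu0 : u = 0 := Subtype.ext (by rw [← hau, ha0, map_zero, Submodule.coe_zero])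
  rw [hu0, TensorProduct.zero_tmul]

/-- **(2), surjectivity onto `A[n]_{-n+2} = A_2`**: the image of `𝔞 ⊗ A_0 → A` is `A_2` (`a = L_a · 1`).
[cite: LooijengaLunts1997, §6 (6.1) (2) p. 23 L17–L18, L28–L29] -/
theorem IsLefschetzAlgebra.range_actionMap (L : IsLefschetzAlgebra K 𝒜 n) :
    LinearMap.range (actionMap K (mulLeftDegTwo K 𝒜) (𝒜 0)) = 𝒜 2 := by
  refine le_antisymm ?_ fun a ha ↦ ?_
  · rintro _ ⟨t, rfl⟩
    obtain ⟨u, rfl⟩ := L.exists_eq_tmul_one t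
    obtain ⟨a, ha, hau⟩ := (mem_mulLeftDegTwo_iff K 𝒜).1 u.2
    rw [actionMap_tmul, ← hau, LinearMap.mul_apply', mul_one]
    exact ha
  · refine ⟨⟨LinearMap.mul K A a, mul_mem_mulLeftDegTwo K 𝒜 ha⟩ ⊗ₜ ⟨1, SetLike.GradedOne.one_mem⟩, ?_⟩
    rw [actionMap_tmul, LinearMap.mul_apply', mul_one]

/-! ### §4 (6.1): "`A[n]` is a Frobenius–Lefschetz module of `A_2` if and only if `A` is generated by `A_2`" -/

variable (K 𝒜) [CharZero K]

/-- `A[n]_{-n} = A_0`. [cite: LooijengaLunts1997, §1 (1.4) p. 5 L19–L20; §6 (6.1) p. 23 L28–L29] -/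
theorem degreeSpace_shiftedDegree_neg (n : ℕ) : degreeSpace (shiftedDegree K 𝒜 n) (-(n : ℤ)) = 𝒜 0 := by
  have h1 := degreeSpace_shiftedDegree_eq K 𝒜 n 0
  rwa [Nat.cast_zero, zero_sub] at h1

/-- `A[n]_{-n+2} = A_2`. [cite: LooijengaLunts1997, §1 (1.4) p. 5 L19–L20; §6 (6.1) (2) p. 23 L17–L18] -/
theorem degreeSpace_shiftedDegree_neg_add_two (n : ℕ) : degreeSpace (shiftedDegree K 𝒜 n) (-(n : ℤ) + 2) = 𝒜 2 := by
  have h1 := degreeSpace_shiftedDegree_eq K 𝒜 n 2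
  rwa [Nat.cast_two, show (2 : ℤ) - n = -(n : ℤ) + 2 by ring] at h1

variable {K 𝒜} [FiniteDimensional K A]

/-- **LOOIJENGA–LUNTS (6.1), REMARK: "Observe that if `A` is Lefschetz algebra of depth `n`, then `A[n]` is a
Frobenius–Lefschetz module of `A_2` if and only if `A` is generated by `A_2`."**  For a Lefschetz algebra `A` of
depth `n` (A1-119 `IsLefschetzAlgebra`): `A[n]` (graded by `h = deg - n`, acted on by `𝔞 = {L_a | a ∈ A_2}`) is
Frobenius–Lefschetz (A1-156 `IsFrobeniusLefschetz`) iff the `K`-subalgebra generated by `A_2` is all of `A`.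
(⇒): condition (3) alone gives it (`adjoin_degreeTwo_eq_top_of_envelopingSpan_eq_top`); (⇐): `dim A_0 = 1`, (2)
(`injective_actionMap`, `range_actionMap`), (3) (`envelopingSpan_mulLeftDegTwo_eq_top`), and `Prim = A_0` is then
automatic (A1-156 `IsFrobeniusLefschetz.mk'`). [cite: LooijengaLunts1997, §6 (6.1) p. 23 L28–L29] -/
theorem IsLefschetzAlgebra.isFrobeniusLefschetz_iff (L : IsLefschetzAlgebra K 𝒜 n) :
    IsFrobeniusLefschetz K (shiftedDegree K 𝒜 n) (mulLeftDegTwo K 𝒜) ↔ Algebra.adjoin K (𝒜 2 : Set A) = ⊤ := by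
  have hd : -(depth (shiftedDegree K 𝒜 n) : ℤ) = -(n : ℤ) := by rw [L.depth_eq]
  constructor
  · intro F
    have h3 := F.envelopingSpan_eq_top
    rw [hd, degreeSpace_shiftedDegree_neg] at h3
    exact adjoin_degreeTwo_eq_top_of_envelopingSpan_eq_top L h3
  · intro htop
    haveI := L.nontrivial
    refine IsFrobeniusLefschetz.mk' L.isLefschetzModule ?_ ?_ ?_ ?_
    · rw [hd, degreeSpace_shiftedDegree_neg]; exact L.finrank_degreeZero
    · rw [hd, degreeSpace_shiftedDegree_neg]; exact L.injective_actionMap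
    · rw [hd, degreeSpace_shiftedDegree_neg, degreeSpace_shiftedDegree_neg_add_two]; exact L.range_actionMap
    · rw [hd, degreeSpace_shiftedDegree_neg]; exact envelopingSpan_mulLeftDegTwo_eq_top htop

end LefschetzAlgebra

/-! ### §5 (rider A1-160) Looijenga–Lunts (2.11): the induction — `u(ex) = [u, e]x + e(ux)` on a generating set propagates to the generated algebra -/

section Generated

variable {K : Type*} [Field K] {A : Type*} [Ring A] [Algebra K A]

/-- A derivation-like operator kills `1`: if `u(xy) = u(x) y + x u(y)` for all `x, y` then `u(1) = 0` (the "only if"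
of "acts as a derivation if (and only if) `u` kills `1`"). [cite: LooijengaLunts1997, §2 (2.11) proof, p. 11 L40–L42] -/
theorem map_one_eq_zero_of_leibniz (u : A →ₗ[K] A) (hu : ∀ x y : A, u (x * y) = u x * y + x * u y) : u 1 = 0 := by
  have h1 := hu 1 1
  rw [mul_one, mul_one, one_mul] at h1
  -- `u 1 = u 1 + u 1`
  have h2 : u 1 + u 1 = u 1 + 0 := by rw [add_zero]; exact h1.symm
  exact add_left_cancel h2

/-- **"If `u ∈ 𝔤_0` and `e ∈ 𝔤_2`, then for all `x ∈ A`, `u(ex) = [u, e]x + e(ux)`"** — the commutator identity in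
`𝔤𝔩(A)`: `u(ex) = [u, L_e](x) + e u(x)` with `[u, L_e] = u L_e - L_e u`. [cite: LooijengaLunts1997, §2 (2.11) proof, p. 11 L40–L41] -/
theorem apply_mul_eq_lie_apply_add (u : Module.End K A) (e x : A) :
    u (e * x) = (⁅u, LinearMap.mul K A e⁆ : Module.End K A) x + e * u x := by
  rw [Ring.lie_def, LinearMap.sub_apply, Module.End.mul_apply, Module.End.mul_apply, LinearMap.mul_apply',
    LinearMap.mul_apply', sub_add_cancel]

/-- If `[u, L_e]` is again a left multiplication `L_t` and `u` kills `1`, then `t = u(e)`: so `u(ex) = u(e)x + e u(x)`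
— the Leibniz rule on the generator `e`. [cite: LooijengaLunts1997, §2 (2.11) proof, p. 11 L40–L42] -/
theorem leibniz_left_of_lie_mul_mem_range {u : Module.End K A} (h1 : u 1 = 0) {e : A}
    (he : (⁅u, LinearMap.mul K A e⁆ : Module.End K A) ∈ LinearMap.range (LinearMap.mul K A)) (x : A) :
    u (e * x) = u e * x + e * u x := by
  obtain ⟨t, ht⟩ := he
  have hte : t = u e := by
    have h2 := apply_mul_eq_lie_apply_add u e 1
    rw [mul_one, h1, mul_zero, add_zero, ← ht, LinearMap.mul_apply', mul_one] at h2
    exact h2.symm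
  rw [apply_mul_eq_lie_apply_add, ← ht, LinearMap.mul_apply', hte]

/-- **(2.11), the induction: "Since `A` is generated by `𝔤_2`, it follows with induction that `u` acts as a derivation
if (and only if) `u` kills `1`."**  General form: let the `K`-algebra `A` be generated by a set `S`, and let
`u ∈ 𝔤𝔩(A)` normalise the left multiplications by `S` into left multiplications (`[u, L_s] ∈ L(A)` for `s ∈ S`).
Then `u` is a derivation of `A` (`u(xy) = u(x)y + x u(y)`) if and only if `u(1) = 0`.  (Induction over
`Algebra.adjoin`: the set of `y` with `u(yx) = u(y)x + y u(x)` for all `x` contains `S` and `K · 1` and is closed under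
sums and products.) [cite: LooijengaLunts1997, §2 (2.11) Proposition and proof, p. 11 L35–L42] -/
theorem leibniz_iff_map_one_eq_zero_of_adjoin_eq_top {S : Set A} (hS : Algebra.adjoin K S = ⊤) {u : Module.End K A}
    (hu : ∀ s ∈ S, (⁅u, LinearMap.mul K A s⁆ : Module.End K A) ∈ LinearMap.range (LinearMap.mul K A)) :
    (∀ x y : A, u (x * y) = u x * y + x * u y) ↔ u 1 = 0 := by
  refine ⟨map_one_eq_zero_of_leibniz u, fun h1 x y ↦ ?_⟩
  have hx : x ∈ Algebra.adjoin K S := by rw [hS]; exact Algebra.mem_top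
  revert y
  refine Algebra.adjoin_induction (p := fun x _ ↦ ∀ y, u (x * y) = u x * y + x * u y) ?_ ?_ ?_ ?_ hx
  · intro s hs y
    exact leibniz_left_of_lie_mul_mem_range h1 (hu s hs) y
  · intro r y
    rw [Algebra.algebraMap_eq_smul_one, smul_mul_assoc, one_mul, map_smul, map_smul, h1, smul_zero, zero_mul,
      zero_add, smul_mul_assoc, one_mul]
  · intro x x' _ _ hx hx' y
    rw [add_mul, map_add, hx, hx', map_add, add_mul, add_mul]
    abel
  · intro x x' _ _ hx hx' y
    rw [mul_assoc, hx, hx', hx x', mul_add, ← mul_assoc, ← mul_assoc, add_mul, mul_assoc x x' (u y), add_assoc]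

end Generated

/-! ### §6 (rider A1-160) For a Lefschetz algebra generated by `A_2`: "`𝔤'_0` acts on `A` as derivations" -/

section LefschetzAlgebraDerivation

variable {K : Type*} [Field K] {A : Type*} [Ring A] [Algebra K A] {𝒜 : ℕ → Submodule K A} [GradedAlgebra 𝒜] {n : ℕ}

omit [GradedAlgebra 𝒜] in
/-- **(2.11) for a graded algebra `A` generated by `A_2`**: an operator `u ∈ 𝔤𝔩(A)` with `[u, L_a] ∈ {L_b | b ∈ A_2}`
for all `a ∈ A_2` ("`u ∈ 𝔤_0` and `e ∈ 𝔤_2` … `[u, e]` … `∈ 𝔤_2`", `𝔤_2 = A_2` acting by left multiplication) acts as a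
derivation of `A` if and only if it kills `1`. [cite: LooijengaLunts1997, §2 (2.10)–(2.11), p. 11 L27–L42] -/
theorem leibniz_iff_map_one_eq_zero_of_adjoin_degTwo_eq_top (hgen : Algebra.adjoin K (𝒜 2 : Set A) = ⊤)
    {u : Module.End K A} (hu : ∀ a ∈ 𝒜 2, (⁅u, LinearMap.mul K A a⁆ : Module.End K A) ∈ mulLeftDegTwo K 𝒜) :
    (∀ x y : A, u (x * y) = u x * y + x * u y) ↔ u 1 = 0 :=
  leibniz_iff_map_one_eq_zero_of_adjoin_eq_top hgen fun a ha ↦ by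
    obtain ⟨b, -, hb⟩ := (mem_mulLeftDegTwo_iff K 𝒜).1 (hu a ha)
    exact ⟨b, hb⟩

variable [CharZero K]

/-- **"`𝔤'_0` … kills `1 ∈ A_0` …; this Lie algebra is complementary to the span of `h` in `𝔤_0`"**, the underlying
computation: in a Lefschetz algebra of depth `n` (`A_0 = K · 1`, `h 1 = -n · 1`, `n ≥ 1`), every operator `u` with
`u(1) ∈ A_0` (e.g. any operator of degree `0`) differs from an operator killing `1` by a UNIQUE multiple of `h`:
`(u + c h)(1) = 0` iff `c = u₀ / n` where `u(1) = u₀ · 1`. [cite: LooijengaLunts1997, §2 (2.10), p. 11 L30–L32] -/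
theorem IsLefschetzAlgebra.existsUnique_add_smul_shiftedDegree_map_one (L : IsLefschetzAlgebra K 𝒜 n)
    {u : Module.End K A} (hu : u 1 ∈ 𝒜 0) :
    ∃! c : K, (u + c • shiftedDegree K 𝒜 n) 1 = 0 := by
  haveI : Nontrivial A := by
    by_contra hA
    rw [not_nontrivial_iff_subsingleton] at hA
    exact L.shiftedDegree_ne_zero (Subsingleton.elim _ _)
  have hn : (n : K) ≠ 0 := by exact_mod_cast (L.depth_pos).ne'
  obtain ⟨u₀, hu₀⟩ := L.exists_algebraMap_eq _ hu
  rw [Algebra.algebraMap_eq_smul_one] at hu₀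
  have hh : shiftedDegree K 𝒜 n 1 = -((n : K) • (1 : A)) := by
    rw [shiftedDegree_apply_of_mem K 𝒜 n (SetLike.GradedOne.one_mem (A := 𝒜)), Nat.cast_zero, zero_sub,
      Int.cast_neg, Int.cast_natCast, neg_smul]
  have key : ∀ c : K, (u + c • shiftedDegree K 𝒜 n) 1 = (u₀ - c * n) • (1 : A) := by
    intro c
    rw [LinearMap.add_apply, LinearMap.smul_apply, hh, ← hu₀, smul_neg, smul_smul, sub_smul, sub_eq_add_neg]
  refine ⟨u₀ / n, ?_, fun c hc ↦ ?_⟩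
  · show (u + (u₀ / n) • shiftedDegree K 𝒜 n) 1 = 0
    rw [key, div_mul_cancel₀ _ hn, sub_self, zero_smul]
  · change (u + c • shiftedDegree K 𝒜 n) 1 = 0 at hc
    rw [key, smul_eq_zero, sub_eq_zero] at hc
    rcases hc with hc | hc
    · rw [hc, mul_div_cancel_right₀ _ hn]
    · exact absurd hc one_ne_zero

end LefschetzAlgebraDerivation

end Literature.Algebra.Lie
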